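import Literature.AlgebraicGeometry.ShimuraVarieties.UnitaryBallQuotientKaehlerPullback
import Literature.AlgebraicGeometry.ShimuraVarieties.UnitaryBallFubiniStudyWeightLaw
import HarnessLib

/-!
# The weight-normalised Fubini–Study class of a compact ball quotient and its functoriality

Layer `Literature/AlgebraicGeometry/ShimuraVarieties`; sequel of `UnitaryBallQuotientKaehlerPullback` (the pinned
Kähler–rational datum, `pullback_map_eq_ofRealClass_fsForm_twist`, `anMap_quotModel_mk`, `frameIso_conj_mem_ballImage`)
and consumer of the named fact `BallFS.fsFormClass_weight_comm` (`UnitaryBallFubiniStudyWeightLaw`, row B3-25′ of the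
`hodgecm-mathlib` cell: `k' · [[G]^*ω_FS] = k · [[G']^*ω_FS]` for projective systems of automorphic forms of weights
`k, k'` on one free ball quotient — Griffiths–Harris Ch. 1 §2: `[G]^*𝒪(1) = K^{⊗k}`). PROVED here (theorems only; no
definition, no new named fact), for a compact ball-quotient datum `D : UnitaryBallUniformisationDatum 2 X` with a
Sylvester frame `𝔣` and classes `c ∈ H²(X(ℂ); ℂ)` «comparing to `[[G]^*ω_FS]`» in the quotient Hodge model
(`(D.quotModel 𝔣)^* c = e[[G]^*ω_FS] ⊗ 1`, the currency of `exists_kaehlerRationalDatum_fsForm`):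

* `smul_eq_smul_of_pullback_eq_fsForm` — **weight normalisation**: if `c₁` compares to `[[G₁]^*ω_FS]` (weight
  `k₁ > 0`) and `c₂` to `[[G₂]^*ω_FS]` (weight `k₂ > 0`), then `k₂ · c₁ = k₁ · c₂`; so the REAL class
  `κ_X := k⁻¹ · c` does not depend on the system (granted `fsFormClass_weight_comm`);
* `isKaehlerClass_smul_of_pullback_eq_fsForm` — every positive real multiple of a class comparing to the
  Fubini–Study form of an IMMERSIVE system is a Kähler class of `X` (Voisin I §3.3.2 Lemma 3.16);
* **`smul_map_eq_smul_of_pullback_eq_fsForm`** — **exact functoriality of `κ`**: for a second datum `D₁` on `X₁`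
  with the same Gram matrix and a morphism `f : X₁ ⟶ X` lying over a translation `v ↦ g v`, `g ∈ U(H^{τ₁})`
  conjugating `Γ₁^{τ₁}` into `Γ^{τ₁}` (level coverings `g = 1`, Hecke translates `g = γ^{ι₁}`), and classes
  `c₁` on `X₁` (weight `k₁`), `c₂` on `X` (weight `k₂`): `k₁ · f(ℂ)^* c₂ = k₂ · c₁`, i.e. `f^* κ_X = κ_{X₁}`
  (`f(ℂ)^* c₂` compares to the twisted system `S_ĝ G₂` of weight `k₂`, Shimura 1971 §7.2).

These are the three local ingredients of the TOWER Kähler class system of the Picard modular surfaces (fan A of the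
`hodgecm-mathlib` cell, junction «Matsushima at the pin», binder `h413`): one global scale `r` making `r · κ` rational at
a reference level makes it rational at every level (finite-cover transfer, `HodgeTheory.IsRationalClass.of_map_isFiniteCover`).

## References

* P. Griffiths, J. Harris, *Principles of Algebraic Geometry* (1978), Ch. 0 §2, Ch. 1 §2. [GriffithsHarrisPrinciples1978]
* I. R. Shafarevich, *Basic Algebraic Geometry 2* (Springer 1994), Ch. IX §3.2. [Shafarevich1994]
* C. Voisin, *Hodge Theory and Complex Algebraic Geometry I* (2002), §3.1.3, §3.3.2 Lemma 3.16, §7.1.2. [VoisinHodgeI2002]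
* G. Shimura, *Introduction to the Arithmetic Theory of Automorphic Functions* (1971), §3.1 Prop. 3.1, §7.2–7.3. [Shimura1971]

## Provenance

hodgecm-mathlib cell, fan A seat A-p09 (g2), binder `h413` (b): the Model-side gluing of row B3-25 reduced to the
weight law `BallFS.fsFormClass_weight_comm` (B-typ03). Everything here is kernel-checked modulo that named fact, taken as
the explicit hypothesis `hFS`.
-/

set_option autoImplicit false

noncomputable section

open scoped Manifold ContDiff Topology InnerProductSpace ComplexConjugate Matrix
open Set Function MulAction Filter Complex
open Literature.Geometry.ComplexHyperbolic
open Literature.Geometry.ComplexHyperbolic.BallModel (U21 Ball)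
open Literature.Geometry.Manifold
open Literature.Geometry.Kaehler
open Literature.Topology.FourManifolds
open Literature.NumberTheory.Automorphic.AutomorphyFactor

namespace Literature.AlgebraicGeometry.ShimuraVarieties

namespace UnitaryBallUniformisationDatum

open Literature.AlgebraicGeometry.HodgeTheory Literature.NumberTheory.Transcendental
open Literature.AlgebraicTopology.SingularHomology (singularCohomology)

/-! ### One datum: weight normalisation and Kählerness -/

section OneDatum

variable {X : Motives.SchemeOver ℂ} (D : UnitaryBallUniformisationDatum 2 X) (𝔣 : D.SylvesterFrame)
  {N₁ k₁ : ℕ} {G₁ : Ball → EuclideanSpace ℂ (Fin (N₁ + 1))}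
  (hG₁h : MDifferentiable 𝓘(ℂ, Fin 2 → ℂ) 𝓘(ℂ, EuclideanSpace ℂ (Fin (N₁ + 1))) G₁)
  (hG₁ : G₁ ∈ factorForms (D.ballImage 𝔣) (BallForms.canonicalCocycle (EuclideanSpace ℂ (Fin (N₁ + 1))) k₁))
  (h₁ : ∀ z, G₁ z ≠ 0)
  {N₂ k₂ : ℕ} {G₂ : Ball → EuclideanSpace ℂ (Fin (N₂ + 1))}
  (hG₂h : MDifferentiable 𝓘(ℂ, Fin 2 → ℂ) 𝓘(ℂ, EuclideanSpace ℂ (Fin (N₂ + 1))) G₂)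
  (hG₂ : G₂ ∈ factorForms (D.ballImage 𝔣) (BallForms.canonicalCocycle (EuclideanSpace ℂ (Fin (N₂ + 1))) k₂))
  (h₂ : ∀ z, G₂ z ≠ 0)

include hG₁h hG₂h in
/-- **Weight normalisation.** If `c₁ ∈ H²(X(ℂ); ℂ)` compares in the quotient model to `[[G₁]^*ω_FS]` (weight `k₁ > 0`)
and `c₂` to `[[G₂]^*ω_FS]` (weight `k₂ > 0`), then `k₂ · c₁ = k₁ · c₂` — the weight law `k₂[[G₁]^*ω_FS] = k₁[[G₂]^*ω_FS]`
pushed through de Rham's isomorphism, the complexification and the comparison of the model.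
[cite: GriffithsHarrisPrinciples1978, Ch. 1 §2] [cite: Shafarevich1994, Ch. IX §3.2] -/
theorem smul_eq_smul_of_pullback_eq_fsForm (hFS : BallFS.fsFormClass_weight_comm) (hk₁ : 0 < k₁) (hk₂ : 0 < k₂)
    {c₁ c₂ : complexBetti X 2}
    (hc₁ : (D.quotModel 𝔣).pullback 2 c₁ = ofRealClass (D.quotientSurface 𝔣) 2
      (integrationDeRhamIsoFamily (Fin 2 → ℂ) (D.quotientSurface 𝔣) 2
        (deRhamCohomology.mk ⟨BallFS.fsForm G₁ hG₁ h₁, BallFS.fsForm_mem_closedSmoothForms hG₁h hG₁ h₁⟩)))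
    (hc₂ : (D.quotModel 𝔣).pullback 2 c₂ = ofRealClass (D.quotientSurface 𝔣) 2
      (integrationDeRhamIsoFamily (Fin 2 → ℂ) (D.quotientSurface 𝔣) 2
        (deRhamCohomology.mk ⟨BallFS.fsForm G₂ hG₂ h₂, BallFS.fsForm_mem_closedSmoothForms hG₂h hG₂ h₂⟩))) :
    (k₂ : ℂ) • c₁ = (k₁ : ℂ) • c₂ := by
  have key := congrArg (fun x ↦ ofRealClass (D.quotientSurface 𝔣) 2
    (integrationDeRhamIsoFamily (Fin 2 → ℂ) (D.quotientSurface 𝔣) 2 x)) (hFS hG₁h hG₁ h₁ hG₂h hG₂ h₂ hk₁ hk₂)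
  simp only [map_smul, ofRealClass_smul, Complex.ofReal_natCast] at key
  apply (D.quotModel 𝔣).pullback_injective 2
  rw [map_smul, map_smul, hc₁, hc₂]
  exact key

include hG₁h in
/-- **Positive multiples of the Fubini–Study class of an immersive system are Kähler classes.** If `c` compares in
the quotient model to `[[G₁]^*ω_FS]` with `G₁` immersive at some lift of every point, then `r · c` is a Kähler class of
`X` for every real `r > 0`: `[G₁]^*ω_FS` is the Kähler form of a Kähler metric on `Δ\𝔹²`
(`BallFS.exists_isKaehler_kaehlerForm_eq_fsForm`) and the Kähler cone is stable under positive scaling.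
[cite: VoisinHodgeI2002, §3.1.3 and §3.3.2 Lemma 3.16] -/
theorem isKaehlerClass_smul_of_pullback_eq_fsForm
    (himm : ∀ y : orbitRel.Quotient (D.ballImage 𝔣) Ball, ∃ z : Ball,
      QuotientManifold.mk (G := D.ballImage 𝔣) z = y ∧
        ∀ (u : TangentSpace 𝓘(ℂ, Fin 2 → ℂ) z) (r : ℂ), mvfderiv 𝓘(ℂ, Fin 2 → ℂ) G₁ z u = r • G₁ z → u = 0)
    {c : complexBetti X 2}
    (hc : (D.quotModel 𝔣).pullback 2 c = ofRealClass (D.quotientSurface 𝔣) 2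
      (integrationDeRhamIsoFamily (Fin 2 → ℂ) (D.quotientSurface 𝔣) 2
        (deRhamCohomology.mk ⟨BallFS.fsForm G₁ hG₁ h₁, BallFS.fsForm_mem_closedSmoothForms hG₁h hG₁ h₁⟩)))
    {r : ℝ} (hr : 0 < r) :
    IsKaehlerClass 2 X ((r : ℂ) • c) := by
  obtain ⟨g₁, hg₁, hg₁ω⟩ := BallFS.exists_isKaehler_kaehlerForm_eq_fsForm hG₁h hG₁ h₁ himm
  have hκ : g₁.kaehlerClass (isSmoothForm_kaehlerForm_of_isManifold_complex_holds
      (E := Fin 2 → ℂ) (M := D.quotientSurface 𝔣)) hg₁ =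
      deRhamCohomology.mk ⟨BallFS.fsForm G₁ hG₁ h₁, BallFS.fsForm_mem_closedSmoothForms hG₁h hG₁ h₁⟩ := by
    unfold Bundle.ContMDiffRiemannianMetric.kaehlerClass
    congr 1
    exact Subtype.ext hg₁ω
  have hK : (D.quotModel 𝔣).IsKaehlerClassVia (integrationDeRhamIsoFamily (Fin 2 → ℂ)) c :=
    ⟨g₁, hg₁, by rw [hc, hκ]⟩
  exact (hK.isKaehlerClass integrationDeRhamIsoFamily_isNatural integrationDeRhamIsoFamily_isMultiplicative).smul_of_pos hr

end OneDatum

/-! ### Two data: exact functoriality of the weight-normalised class -/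

section TwoData

variable {X X₁ : Motives.SchemeOver ℂ} (D : UnitaryBallUniformisationDatum 2 X) (D₁ : UnitaryBallUniformisationDatum 2 X₁)
  (hH : D₁.Hℂ = D.Hℂ) (𝔣 : D.SylvesterFrame)

/-- **Exact functoriality of the weight-normalised Fubini–Study class.** Let `f : X₁ ⟶ X` lie over the translation
`v ↦ g v` of the negative cone, `g ∈ U(H^{τ₁})` conjugating `Γ₁^{τ₁}` into `Γ^{τ₁}` (data with the same Gram matrix, one
frame `𝔣`, transported to `D₁`). If `c₁ ∈ H²(X₁(ℂ); ℂ)` compares to `[[G₁]^*ω_FS]` for a system `G₁` of weight `k₁ > 0` on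
`Δ₁\𝔹²` and `c₂ ∈ H²(X(ℂ); ℂ)` to `[[G₂]^*ω_FS]` for a system `G₂` of weight `k₂ > 0` on `Δ\𝔹²`, then
`k₁ · f(ℂ)^* c₂ = k₂ · c₁` — that is `f^*(k₂⁻¹ c₂) = k₁⁻¹ c₁`: `f(ℂ)^* c₂` compares to the TWISTED system `S_ĝ G₂` of weight `k₂`
on `Δ₁\𝔹²` (`pullback_map_eq_ofRealClass_fsForm_twist`) and the weight law normalises it against `G₁`.
[cite: Shimura1971, §3.1 Prop. 3.1, §7.2–7.3] [cite: GriffithsHarrisPrinciples1978, Ch. 1 §2] -/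
theorem smul_map_eq_smul_of_pullback_eq_fsForm (hFS : BallFS.fsFormClass_weight_comm)
    {g : GL (Fin 3) ℂ} (hg : g ∈ D.realPoints)
    (hΓ : (D₁.Γ.map (Matrix.GeneralLinearGroup.map D₁.τ₁)).map (MulAut.conj g).toMonoidHom ≤
      D.Γ.map (Matrix.GeneralLinearGroup.map D.τ₁))
    (f : X₁ ⟶ X)
    (hf : ∀ v ∈ D₁.cone, Motives.AlgPoints.map f (D₁.unif v) = D.unif ((g : Matrix (Fin 3) (Fin 3) ℂ) *ᵥ v))
    {N₁ k₁ : ℕ} {G₁ : Ball → EuclideanSpace ℂ (Fin (N₁ + 1))}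
    (hG₁h : MDifferentiable 𝓘(ℂ, Fin 2 → ℂ) 𝓘(ℂ, EuclideanSpace ℂ (Fin (N₁ + 1))) G₁)
    (hG₁ : G₁ ∈ factorForms (D₁.ballImage (SylvesterFrame.transport hH 𝔣))
      (BallForms.canonicalCocycle (EuclideanSpace ℂ (Fin (N₁ + 1))) k₁))
    (h₁ : ∀ z, G₁ z ≠ 0) (hk₁ : 0 < k₁)
    {N₂ k₂ : ℕ} {G₂ : Ball → EuclideanSpace ℂ (Fin (N₂ + 1))}
    (hG₂h : MDifferentiable 𝓘(ℂ, Fin 2 → ℂ) 𝓘(ℂ, EuclideanSpace ℂ (Fin (N₂ + 1))) G₂)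
    (hG₂ : G₂ ∈ factorForms (D.ballImage 𝔣) (BallForms.canonicalCocycle (EuclideanSpace ℂ (Fin (N₂ + 1))) k₂))
    (h₂ : ∀ z, G₂ z ≠ 0) (hk₂ : 0 < k₂)
    {c₁ : complexBetti X₁ 2} {c₂ : complexBetti X 2}
    (hc₁ : (D₁.quotModel (SylvesterFrame.transport hH 𝔣)).pullback 2 c₁ =
      ofRealClass (D₁.quotientSurface (SylvesterFrame.transport hH 𝔣)) 2
        (integrationDeRhamIsoFamily (Fin 2 → ℂ) (D₁.quotientSurface (SylvesterFrame.transport hH 𝔣)) 2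
          (deRhamCohomology.mk ⟨BallFS.fsForm G₁ hG₁ h₁, BallFS.fsForm_mem_closedSmoothForms hG₁h hG₁ h₁⟩)))
    (hc₂ : (D.quotModel 𝔣).pullback 2 c₂ = ofRealClass (D.quotientSurface 𝔣) 2
      (integrationDeRhamIsoFamily (Fin 2 → ℂ) (D.quotientSurface 𝔣) 2
        (deRhamCohomology.mk ⟨BallFS.fsForm G₂ hG₂ h₂, BallFS.fsForm_mem_closedSmoothForms hG₂h hG₂ h₂⟩))) :
    (k₁ : ℂ) • singularCohomology.map ℂ ℂ (Motives.AlgPoints.mapContinuous (L := ℂ) f) 2 c₂ = (k₂ : ℂ) • c₁ := by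
  have hconj := D₁.frameIso_conj_mem_ballImage D hH 𝔣 hg hΓ
  have htw := D₁.pullback_map_eq_ofRealClass_fsForm_twist D (SylvesterFrame.transport hH 𝔣) 𝔣 hG₂h hG₂ h₂ f hconj
    (D₁.anMap_quotModel_mk D hH 𝔣 hg f hf) hc₂
  exact D₁.smul_eq_smul_of_pullback_eq_fsForm (SylvesterFrame.transport hH 𝔣)
    (BallFS.mdifferentiable_twist _ hG₂h) (BallFS.twist_mem_factorForms hconj hG₂) (BallFS.twist_ne_zero _ h₂)
    hG₁h hG₁ h₁ hFS hk₂ hk₁ htw hc₁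

end TwoData

end UnitaryBallUniformisationDatum

end Literature.AlgebraicGeometry.ShimuraVarieties

end
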